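import Literature.AnabelianGeometry.EtaleTheta.SettingModelChiTwistedLatticeKernels
import HarnessLib

/-!
# The χ-twisted root model with an extra Tate lattice, file 2a: the theta-quotient embedding `(Π^tp_Xχ)^Θ ↪ (Π^tp_X□)^Θ`
# and the theta-centre identification `Δ_Θ(curveχ) ≃* Δ_Θ(curveLat)` (coefficient input of the Kummer core of `modelLat`)

Mochizuki, *The étale theta function …*, Publ. RIMS **45** (2009) [EtTh], §1, PRIMS PDF p. 12 ("`Δ_Θ` (`≅ Ẑ(1)`) …
the kernel of `(Π^tp_X)^Θ ↠ (Π^tp_X)^ell`") [cite: MochizukiEtTh2009, §1 p.12].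

LATTICE TWIST OF `Ẑ(1)²` — NOT the (B) section twist (cf. file 1, `SettingModelChiTwistedLattice.lean`, and abc-iut-L2-lead
R709).  abc-iut cell, K-L6 slice, row «KL6-CLOSURE-CERT F-2633», seat abc-iut-L6-t19 (gen 8).  Over files 1–1f
(`iotaPi`, `iotaPi_mem_thetaKer_iff`, `iotaPi_mem_ellKer_iff`, `exists_iotaPi_eq_of_mem_ellKer`) and abc-iut-L2-d1's generic
theta quotients `CurveTheta.*`:

* **`iotaTheta p : (Π^tp_Xχ)^Θ →* (Π^tp_X□)^Θ`** — `QuotientGroup.map` of the slice embedding `ι` (the theta kernel of `curveχ`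
  maps into that of `curveLat`); `iotaTheta ∘ toThetaχ = toTheta□ ∘ ι`; continuous; INJECTIVE (`iotaPi_mem_thetaKer_iff`);
* **`map_iotaTheta_deltaTheta`**: `iotaTheta(Δ_Θ(curveχ)) = Δ_Θ(curveLat)` (`Δ_Θ = Ker(θ ↠ ell)`; surjectivity because the ell
  kernel of `curveLat` lies in the image of `ι`);
* **`deltaThetaIota p : Δ_Θ(curveχ) ≃* Δ_Θ(curveLat)`**, with `coe_deltaThetaIota` — the identification through which file 2
  transports abc-iut-L6-d6's `Ẑ`-coordinates `c^t` (`deltaThetaCoordχ`) and the Kummer coefficient map to `modelLat`.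

HONEST LABEL: semi-synthetic model bookkeeping; nothing of [EtTh] asserted; no side taken on [IUTchIII] Cor. 3.12.  Class (b)
construction file (def-bearing: `iotaTheta`, `deltaThetaIota`; no instance, no notation, no Prop-valued def).
-/

noncomputable section

namespace Literature.AnabelianGeometry.EtaleTheta.SettingModel

open Literature.AnabelianGeometry.SemiGraphs _root_.Topology _root_.Function

variable (p : ℕ) [Fact p.Prime]

/-- The theta kernel of `curveχ` maps into the theta kernel of `curveLat` under `ι`. [cite: MochizukiEtTh2009, §1 p.12] -/
theorem thetaKerχ_le_comap_iotaPi :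
    CurveTheta.thetaKer (curveχ p) ≤ (CurveTheta.thetaKer (curveLat p)).comap (iotaPi p).toMonoidHom :=
  fun _ hg => iotaPi_mem_thetaKer p hg

/-- **`(Π^tp_Xχ)^Θ → (Π^tp_X□)^Θ`** induced by the slice embedding. [cite: MochizukiEtTh2009, §1 p.12] -/
def iotaTheta : CurveTheta.GTheta (curveχ p) →* CurveTheta.GTheta (curveLat p) :=
  QuotientGroup.map _ _ (iotaPi p).toMonoidHom (thetaKerχ_le_comap_iotaPi p)

/-- `iotaTheta ∘ toThetaχ = toTheta□ ∘ ι`. [cite: MochizukiEtTh2009, §1 p.12] -/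
theorem iotaTheta_toTheta (g : PiTpχ p) :
    iotaTheta p (CurveTheta.toTheta (curveχ p) g) = CurveTheta.toTheta (curveLat p) (iotaPi p g) := rfl

/-- `iotaTheta` is continuous (quotient topologies). [cite: MochizukiEtTh2009, §1 p.12] -/
theorem continuous_iotaTheta : Continuous (iotaTheta p) := by
  have hq : IsQuotientMap (CurveTheta.toTheta (curveχ p) : PiTpχ p → CurveTheta.GTheta (curveχ p)) :=
    QuotientGroup.isQuotientMap_mk _
  refine hq.continuous_iff.2 ?_
  have e : (iotaTheta p) ∘ (CurveTheta.toTheta (curveχ p)) = (CurveTheta.toTheta (curveLat p)) ∘ (iotaPi p) := rfl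
  rw [e]
  exact (CurveTheta.continuous_toTheta (curveLat p)).comp (iotaPi p).continuous

/-- `iotaTheta` is injective (`ι g` lies in the theta kernel of `curveLat` iff `g` lies in that of `curveχ`).
[cite: MochizukiEtTh2009, §1 p.12] -/
theorem iotaTheta_injective : Injective (iotaTheta p) := by
  rw [← MonoidHom.ker_eq_bot_iff, eq_bot_iff]
  intro x hx
  obtain ⟨g, rfl⟩ := CurveTheta.toTheta_surjective (curveχ p) x
  rw [MonoidHom.mem_ker, iotaTheta_toTheta] at hx
  have hg : iotaPi p g ∈ CurveTheta.thetaKer (curveLat p) := by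
    rw [CurveTheta.mem_thetaKer_iff]
    have := (QuotientGroup.eq_one_iff (iotaPi p g)).mp hx
    exact (CurveTheta.mem_thetaKer_iff (curveLat p) _).mp this
  have hg' : g ∈ CurveTheta.thetaKer (curveχ p) := (iotaPi_mem_thetaKer_iff p g).mp hg
  rw [Subgroup.mem_bot]
  exact (QuotientGroup.eq_one_iff g).mpr hg'

/-- **`iotaTheta(Δ_Θ(curveχ)) = Δ_Θ(curveLat)`** (`Δ_Θ = Ker((·)^Θ ↠ (·)^ell)`). [cite: MochizukiEtTh2009, §1 p.12] -/
theorem map_iotaTheta_deltaTheta :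
    ((CurveTheta.thetaToEll (curveχ p)).ker).map (iotaTheta p) = (CurveTheta.thetaToEll (curveLat p)).ker := by
  apply le_antisymm
  · rintro _ ⟨x, hx, rfl⟩
    obtain ⟨g, hg, rfl⟩ := CurveTheta.exists_eq_toTheta_of_mem_ker_thetaToEll (curveχ p) hx
    rw [iotaTheta_toTheta]
    exact (CurveTheta.mk_mem_ker_thetaToEll_iff (curveLat p) _).mpr (iotaPi_mem_ellKer p hg)
  · intro y hy
    obtain ⟨x, hx, rfl⟩ := CurveTheta.exists_eq_toTheta_of_mem_ker_thetaToEll (curveLat p) hy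
    obtain ⟨g, rfl⟩ := exists_iotaPi_eq_of_mem_ellKer p hx
    refine ⟨CurveTheta.toTheta (curveχ p) g, ?_, iotaTheta_toTheta p g⟩
    exact (CurveTheta.mk_mem_ker_thetaToEll_iff (curveχ p) _).mpr ((iotaPi_mem_ellKer_iff p g).mp hx)

/-- **`Δ_Θ(curveχ) ≃* Δ_Θ(curveLat)`** through `iotaTheta`. [cite: MochizukiEtTh2009, §1 p.12] -/
def deltaThetaIota : (CurveTheta.thetaToEll (curveχ p)).ker ≃* (CurveTheta.thetaToEll (curveLat p)).ker :=
  (MulEquiv.ofBijective ((iotaTheta p).subgroupMap (CurveTheta.thetaToEll (curveχ p)).ker)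
      ⟨fun _ _ h => Subtype.ext (iotaTheta_injective p (congrArg Subtype.val h)),
        MonoidHom.subgroupMap_surjective _ _⟩).trans
    (MulEquiv.subgroupCongr (map_iotaTheta_deltaTheta p))

/-- `deltaThetaIota` is `iotaTheta` on underlying elements. [cite: MochizukiEtTh2009, §1 p.12] -/
@[simp] theorem coe_deltaThetaIota (a : (CurveTheta.thetaToEll (curveχ p)).ker) :
    ((deltaThetaIota p a : (CurveTheta.thetaToEll (curveLat p)).ker) : CurveTheta.GTheta (curveLat p)) = iotaTheta p a :=
  rfl

/-- `deltaThetaIota` is continuous (subspace topologies of the quotient topologies). [cite: MochizukiEtTh2009, §1 p.12] -/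
theorem continuous_deltaThetaIota : Continuous (deltaThetaIota p) :=
  Continuous.subtype_mk ((continuous_iotaTheta p).comp continuous_subtype_val) _

/-- The theta centres of the two ROOT RECORDS: `(modelLat p).DeltaTheta` is `Ker(θ ↠ ell)` of `curveLat` and
`(modelχ p).DeltaTheta` that of `curveχ` (both by construction of the records). [cite: MochizukiEtTh2009, §1 p.12] -/
theorem deltaTheta_modelLat_eq : (ThetaSetting.modelLat p).DeltaTheta = (CurveTheta.thetaToEll (curveLat p)).ker := rfl

/-- [cite: MochizukiEtTh2009, §1 p.12] -/
theorem deltaTheta_modelχ_eq : (ThetaSetting.modelχ p).DeltaTheta = (CurveTheta.thetaToEll (curveχ p)).ker := rfl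

end Literature.AnabelianGeometry.EtaleTheta.SettingModel

end
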